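import Mathlib.Analysis.Complex.Polynomial.Basic
import Literature.NumberTheory.Automorphic.ArchParameterUnique
import HarnessLib

/-!
# A `𝔤𝔩ₙ(𝕜)`-module with an infinitesimal character has a Harish-Chandra parameter
(characters of `Z(𝔤) ⊗ ℂ ≅ ℂ[x_{τ,i}]^{∏_τ 𝔖ₙ}` are evaluations at points of `𝔥_ℂ^*`; theorems only)

Topic `NumberTheory/Automorphic`; a proof file (theorems only) next to `HarishChandraGL`,
`HarishChandraGLIsomorphism` and `ArchParameterUnique`. `𝕜` is `ℝ` or `ℂ`, `𝔤 = 𝔤𝔩ₙ(𝕜)` as a real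
Lie algebra, `Z(𝔤)` the centre of its real enveloping algebra, `γ : Z(𝔤) → ℂ[x_{τ,i}]` the
Harish-Chandra homomorphism (`harishChandraHomGL`, unique: `harishChandraHomGL_unique_holds`), whose
complexification is an isomorphism onto the `∏_τ 𝔖ₙ`-symmetric polynomials
(`HarishChandraHomGL.baseChange_injective_and_range_eq`, Harish-Chandra's theorem, proved in the
tree).

* `exists_fun_esymm_eq` — prescribed elementary symmetric functions: for any `c₁, …, c_n ∈ ℂ` there
  is `x : Fin n → ℂ` with `e_k(x) = c_k` (the roots of `X^n - c₁ X^{n-1} + ⋯ ± c_n`; `ℂ`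
  algebraically closed, Vieta).
* `exists_point_of_algHom_symmetricSubalgebraGL` — **every `ℂ`-algebra character of
  `ℂ[x_{τ,i}]^{∏_τ 𝔖ₙ}` is evaluation at a point** `x ∈ ∏_τ ℂⁿ = 𝔥_ℂ^*` (the block elementary
  symmetric polynomials generate — the fundamental theorem of block-symmetric polynomials,
  `exists_blockEsymmAeval_eq_of_mem` of `Literature.RingTheory.MvPolynomial.BlockSymmetric` — and
  their values can be prescribed blockwise). Equivalently: the maximal ideals of `S(𝔥_ℂ)^W` are the
  contractions of those of `S(𝔥_ℂ)` (Chevalley; Humphreys 1972, §23.3).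
* `aeval_eq_aeval_of_map_univ_eq` — the value of a symmetric polynomial at `x` only depends on the
  multisets `{x_{τ,1}, …, x_{τ,n}}`.
* `exists_hasHCParameter_of_hasCentralCharacter` — **a `𝔤𝔩ₙ(𝕜)`-module with an infinitesimal
  character `θ : Z(𝔤) → ℂ` has a Harish-Chandra parameter** `χ` (`HasHCParameter`): `θ_ℂ ∘ γ_ℂ⁻¹`
  is a character of `ℂ[x_{τ,i}]^{∏ 𝔖ₙ}`, hence evaluation at some `x`, and `χ τ = {x_{τ,i}}_i`
  (Knapp 2002, Thm. 5.44 with Prop. 5.32: infinitesimal characters of `U(𝔤_ℂ)` are the `χ_λ`,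
  `λ ∈ 𝔥_ℂ^*`, `χ_λ = χ_{λ'} ↔ λ' ∈ Wλ`). With `HasHCParameter.unique` (`ArchParameterUnique`) the
  parameter is unique on non-zero modules.
* `UniversalEnvelopingAlgebra.induction_on'`, `….mem_center_of_forall_commute_ι`,
  `….lift_comp_apply`, `HasCentralCharacter.exists_comp` — `𝔤` generates `U(𝔤)`; pull-back of
  an infinitesimal character along a Lie algebra map `f` with `U(f)(Z(𝔤₁)) ⊆ Z(𝔤₂)`.
* `eq_sum_realPlaceLie_add_sum_complexPlaceLie`, `realPlaceLie_mul_realPlaceLie_of_ne`, … —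
  `𝔤𝔩ₙ(K_∞) = ⨁_w 𝔤𝔩ₙ(K_w)` with pairwise commuting (indeed mutually annihilating) factors; hence
  `lift_realPlaceLie_mem_center`, `lift_complexPlaceLie_mem_center`: `Z(U(𝔤𝔩ₙ(K_w)))` is central
  in `U(𝔤𝔩ₙ(K_∞))`.
* `exists_hasArchParameter_of_hasCentralCharacter` and
  **`AutomorphicRepData.exists_hasArchParameter_of_hasInfinitesimalCharacter`** — an automorphic
  representation of `GL_n(𝔸_K)` (Borel–Jacquet datum) with an infinitesimal character has an
  archimedean parameter (`AutomorphicRepData.HasArchParameter`, Clozel 1990 §3.3): the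
  `HasArchParameter` half of the existence of an infinity type reduces to Schur's lemma for
  `W / W'`.

## References

* A. W. Knapp, *Lie Groups Beyond an Introduction*, 2nd ed. (2002), §V.5, Prop. 5.32, Thm. 5.44.
  [Knapp2002]
* J. E. Humphreys, *Introduction to Lie Algebras and Representation Theory* (1972), §23.3.
* L. Clozel, *Motifs et formes automorphes* (1990), §3.3. [Clozel1990]
* A. Borel, H. Jacquet, *Automorphic forms and automorphic representations*, Corvallis 1979, §4.6.
  [BorelJacquet1979]
* J. Dixmier, *Enveloping Algebras* (1977/1996), 2.1.1.
-/

-- Mathlib idiom (Mathlib/Algebra/Lie/OfAssociative.lean): the commutator bracket on associative rings;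
-- needed to state `𝔤𝔩ₙ(𝕜) →ₗ⁅ℝ⁆ End V` (as in `HarishChandraGL`, `ArchParameterUnique`)
attribute [local instance 100] LieRing.ofAssociativeRing

open scoped TensorProduct Polynomial
open Polynomial Literature.RingTheory.MvPolynomial.BlockSymmetric

noncomputable section

namespace Literature.NumberTheory.Automorphic

/-! ### Prescribing elementary symmetric functions (Vieta over `ℂ`) -/

section Vieta

/-- A multiset with `n` elements is enumerated by `Fin n`. [folklore] -/
theorem exists_enum_of_card_eq' {α : Type*} {n : ℕ} (s : Multiset α) (hs : Multiset.card s = n) :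
    ∃ l : Fin n → α, Finset.univ.val.map l = s := by
  induction s using Quotient.inductionOn with
  | h L =>
    have hL : L.length = n := by simpa using hs
    subst hL
    exact ⟨L.get, by rw [Fin.univ_val_map, List.ofFn_get]; rfl⟩

/-- **Prescribed elementary symmetric functions**: for every sequence `c₁, …, c_n` of complex
numbers there are `x₁, …, x_n ∈ ℂ` with `e_k(x₁, …, x_n) = c_k` for `1 ≤ k ≤ n` — the roots of the
monic polynomial `X^n - c₁ X^{n-1} + c₂ X^{n-2} - ⋯ + (-1)^n c_n`, which splits over `ℂ` (Vieta's
formulae `Multiset.prod_X_sub_C_coeff`). [folklore] -/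
theorem exists_fun_esymm_eq (n : ℕ) (c : ℕ → ℂ) :
    ∃ x : Fin n → ℂ, ∀ k, 1 ≤ k → k ≤ n → (Finset.univ.val.map x).esymm k = c k := by
  -- the polynomial `q = X^n + ∑_{1 ≤ m ≤ n} (-1)^m c_m X^{n-m}`
  set r : ℂ[X] := ∑ m ∈ Finset.Icc 1 n, C ((-1) ^ m * c m) * X ^ (n - m) with hr
  set q : ℂ[X] := X ^ n + r with hq
  have hrdeg : r.degree < n := by
    rw [hr]
    refine (degree_sum_le _ _).trans_lt ?_
    refine (Finset.sup_lt_iff (WithBot.bot_lt_coe n)).2 fun m hm => ?_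
    rw [Finset.mem_Icc] at hm
    refine (degree_C_mul_X_pow_le _ _).trans_lt ?_
    exact WithBot.coe_lt_coe.2 (show n - m < n by omega)
  have hmonic : q.Monic := monic_X_pow_add hrdeg
  have hqdeg : q.natDegree = n := by
    rw [hq, natDegree_add_eq_left_of_degree_lt (by rwa [degree_X_pow]), natDegree_X_pow]
  -- its coefficients
  have hcoeff : ∀ m, 1 ≤ m → m ≤ n → q.coeff (n - m) = (-1) ^ m * c m := by
    intro m hm1 hmn
    rw [hq, coeff_add, coeff_X_pow, if_neg (by omega), zero_add, hr, finsetSum_coeff]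
    rw [Finset.sum_eq_single m]
    · rw [coeff_C_mul, coeff_X_pow, if_pos rfl, mul_one]
    · intro m' hm' hne
      rw [Finset.mem_Icc] at hm'
      rw [coeff_C_mul, coeff_X_pow, if_neg (by omega), mul_zero]
    · intro hm
      exact absurd (Finset.mem_Icc.2 ⟨hm1, hmn⟩) hm
  -- its roots
  set s := q.roots with hs
  have hcard' : Multiset.card q.roots = q.natDegree := IsAlgClosed.card_roots_eq_natDegree
  have hcard : Multiset.card s = n := by rw [hs, hcard', hqdeg]
  have hprod : (s.map fun a => X - C a).prod = q :=
    prod_multiset_X_sub_C_of_monic_of_roots_card_eq hmonic hcard'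
  obtain ⟨x, hx⟩ := exists_enum_of_card_eq' s hcard
  refine ⟨x, fun k hk1 hkn => ?_⟩
  rw [hx]
  -- compare the coefficients of `X^{n-k}`
  have h1 : q.coeff (n - k) = (-1) ^ (Multiset.card s - (n - k)) * s.esymm (Multiset.card s - (n - k)) := by
    rw [← hprod]
    exact Multiset.prod_X_sub_C_coeff s (by rw [hcard]; omega)
  rw [hcard, show n - (n - k) = k by omega, hcoeff k hk1 hkn] at h1
  have hu : IsUnit ((-1 : ℂ) ^ k) := (isUnit_one.neg).pow k
  exact (hu.mul_right_inj.mp h1).symm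

end Vieta

/-! ### Characters of the symmetric polynomials are point evaluations -/

section Characters

variable {𝕜 : Type*} [RCLike 𝕜] {n : ℕ}

/-- The value of the block elementary symmetric polynomial `e_m(x_{τ,·})` at a point is the
elementary symmetric function of the multiset `{x_{τ,i}}_i`. [folklore] -/
theorem aeval_besymm (x : (𝕜 →ₐ[ℝ] ℂ) → Fin n → ℂ) (τ : 𝕜 →ₐ[ℝ] ℂ) (m : ℕ) :
    MvPolynomial.aeval (fun p : (𝕜 →ₐ[ℝ] ℂ) × Fin n => x p.1 p.2) (besymm ℂ τ m) =
      (Finset.univ.val.map (x τ)).esymm m := by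
  rw [besymm, MvPolynomial.aeval_rename, MvPolynomial.aeval_esymm_eq_multiset_esymm]
  rfl

/-- **The value of a `∏_τ 𝔖ₙ`-symmetric polynomial at a point `x` only depends on the multisets
`{x_{τ,i}}_i`** (it is a polynomial in the block elementary symmetric functions, by the fundamental
theorem of block-symmetric polynomials `exists_blockEsymmAeval_eq_of_mem`). [folklore] -/
theorem aeval_eq_aeval_of_map_univ_eq {q : MvPolynomial ((𝕜 →ₐ[ℝ] ℂ) × Fin n) ℂ}
    (hq : q ∈ symmetricSubalgebraGL 𝕜 n) {l l' : (𝕜 →ₐ[ℝ] ℂ) → Fin n → ℂ}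
    (h : ∀ τ, Finset.univ.val.map (l τ) = Finset.univ.val.map (l' τ)) :
    MvPolynomial.aeval (fun p : (𝕜 →ₐ[ℝ] ℂ) × Fin n => l p.1 p.2) q =
      MvPolynomial.aeval (fun p : (𝕜 →ₐ[ℝ] ℂ) × Fin n => l' p.1 p.2) q := by
  classical
  rw [symmetricSubalgebraGL_eq_blockSymmetricSubalgebra] at hq
  obtain ⟨G, rfl⟩ := exists_blockEsymmAeval_eq_of_mem hq
  rw [blockEsymmAeval, MvPolynomial.comp_aeval_apply, MvPolynomial.comp_aeval_apply]
  have hfun : (fun i : (𝕜 →ₐ[ℝ] ℂ) × Fin n =>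
        MvPolynomial.aeval (fun p : (𝕜 →ₐ[ℝ] ℂ) × Fin n => l p.1 p.2) (besymm ℂ i.1 (i.2 + 1))) =
      fun i => MvPolynomial.aeval (fun p : (𝕜 →ₐ[ℝ] ℂ) × Fin n => l' p.1 p.2)
        (besymm ℂ i.1 (i.2 + 1)) :=
    funext fun i => by rw [aeval_besymm, aeval_besymm, h]
  rw [hfun]

/-- **Every `ℂ`-algebra character of `ℂ[x_{τ,i}]^{∏_τ 𝔖ₙ}` is evaluation at a point of
`𝔥_ℂ^* = ∏_τ ℂⁿ`**: given `ψ`, choose `x_{τ,·}` with `e_m(x_{τ,·}) = ψ(e_m(x_{τ,·}))` (Vieta,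
`exists_fun_esymm_eq`); then `ψ` and evaluation at `x` are two algebra characters agreeing on the
block elementary symmetric polynomials, which generate (`exists_blockEsymmAeval_eq_of_mem`).
(Chevalley: `S(𝔥)^W` is a polynomial ring and `S(𝔥)` is integral over it; Humphreys 1972, §23.3;
Knapp 2002, Prop. 5.32.) [cite: Knapp2002, §V.5 Prop. 5.32] -/
theorem exists_point_of_algHom_symmetricSubalgebraGL (ψ : symmetricSubalgebraGL 𝕜 n →ₐ[ℂ] ℂ) :
    ∃ x : (𝕜 →ₐ[ℝ] ℂ) → Fin n → ℂ, ∀ (q : MvPolynomial ((𝕜 →ₐ[ℝ] ℂ) × Fin n) ℂ)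
      (hq : q ∈ symmetricSubalgebraGL 𝕜 n),
      ψ ⟨q, hq⟩ = MvPolynomial.aeval (fun p : (𝕜 →ₐ[ℝ] ℂ) × Fin n => x p.1 p.2) q := by
  classical
  -- prescribe the values of the block elementary symmetric polynomials
  have hmem : ∀ (τ : 𝕜 →ₐ[ℝ] ℂ) (m : ℕ), besymm ℂ τ m ∈ symmetricSubalgebraGL 𝕜 n := fun τ m => by
    rw [symmetricSubalgebraGL_eq_blockSymmetricSubalgebra]; exact besymm_mem τ m
  choose x hx using fun τ : 𝕜 →ₐ[ℝ] ℂ =>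
    exists_fun_esymm_eq n fun m => ψ ⟨besymm ℂ τ m, hmem τ m⟩
  refine ⟨x, fun q hq => ?_⟩
  -- `q` is a polynomial in the block elementary symmetric polynomials
  have hq' := hq
  rw [symmetricSubalgebraGL_eq_blockSymmetricSubalgebra] at hq'
  obtain ⟨G, hG⟩ := exists_blockEsymmAeval_eq_of_mem hq'
  -- the two characters, pulled back to the polynomial ring in the `Y_{τ,k}`
  have hcod : ∀ G : MvPolynomial ((𝕜 →ₐ[ℝ] ℂ) × Fin n) ℂ,
      blockEsymmAeval (𝕜 →ₐ[ℝ] ℂ) n ℂ G ∈ symmetricSubalgebraGL 𝕜 n := fun G => by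
    rw [symmetricSubalgebraGL_eq_blockSymmetricSubalgebra]; exact blockEsymmAeval_mem G
  set F₁ : MvPolynomial ((𝕜 →ₐ[ℝ] ℂ) × Fin n) ℂ →ₐ[ℂ] ℂ :=
    ψ.comp ((blockEsymmAeval (𝕜 →ₐ[ℝ] ℂ) n ℂ).codRestrict (symmetricSubalgebraGL 𝕜 n) hcod) with hF₁
  set F₂ : MvPolynomial ((𝕜 →ₐ[ℝ] ℂ) × Fin n) ℂ →ₐ[ℂ] ℂ :=
    (MvPolynomial.aeval (fun p : (𝕜 →ₐ[ℝ] ℂ) × Fin n => x p.1 p.2)).comp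
      (blockEsymmAeval (𝕜 →ₐ[ℝ] ℂ) n ℂ) with hF₂
  have hF : F₁ = F₂ := by
    refine MvPolynomial.algHom_ext fun p => ?_
    have hX : blockEsymmAeval (𝕜 →ₐ[ℝ] ℂ) n ℂ (MvPolynomial.X p) = besymm ℂ p.1 (p.2 + 1) := by
      rw [blockEsymmAeval, MvPolynomial.aeval_X]
    have h1 : F₁ (MvPolynomial.X p) = ψ ⟨besymm ℂ p.1 (p.2 + 1), hmem p.1 _⟩ := by
      rw [hF₁, AlgHom.comp_apply]
      congr 1
      exact Subtype.ext (by rw [AlgHom.coe_codRestrict, hX])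
    have h2 : F₂ (MvPolynomial.X p) = (Finset.univ.val.map (x p.1)).esymm (p.2 + 1) := by
      rw [hF₂, AlgHom.comp_apply, hX, aeval_besymm]
    rw [h1, h2, hx p.1 (p.2 + 1) (Nat.succ_pos _) p.2.is_lt]
  have e1 : ψ ⟨q, hq⟩ = F₁ G := by
    rw [hF₁, AlgHom.comp_apply]
    congr 1
    exact Subtype.ext (by rw [AlgHom.coe_codRestrict, hG])
  rw [e1, hF, hF₂, AlgHom.comp_apply, hG]

end Characters

/-! ### Infinitesimal character ⟹ Harish-Chandra parameter -/

section Parameter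

variable {𝕜 : Type*} [RCLike 𝕜] {n : ℕ} {V : Type*} [AddCommGroup V] [Module ℂ V]
  (ρ𝔤 : Matrix (Fin n) (Fin n) 𝕜 →ₗ⁅ℝ⁆ Module.End ℂ V)

/-- **A `𝔤𝔩ₙ(𝕜)`-module with an infinitesimal character has a Harish-Chandra parameter.** If
`Z(𝔤)` acts on `V` through the character `θ : Z(𝔤) →ₐ[ℝ] ℂ` (`HasCentralCharacter`), then for
some `χ : (𝕜 →ₐ[ℝ] ℂ) → Multiset ℂ` (multisets of `n` numbers), `θ(z) = γ(z)(χ)` for the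
Harish-Chandra homomorphism `γ` and every `z` (`HasHCParameter`): the complexification `θ_ℂ` of
`θ` is a `ℂ`-algebra character of `ℂ ⊗_ℝ Z(𝔤) ≅ ℂ[x_{τ,i}]^{∏_τ 𝔖ₙ}` (Harish-Chandra's
isomorphism `γ_ℂ`, `HarishChandraHomGL.baseChange_injective_and_range_eq`), hence evaluation at a
point `x` (`exists_point_of_algHom_symmetricSubalgebraGL`), and `χ τ = {x_{τ,i}}_i`; the value at
any other enumeration of these multisets is the same (`aeval_eq_aeval_of_map_univ_eq`), and `γ` is
unique (`harishChandraHomGL_unique_holds`). Knapp 2002, Thm. 5.44 with Prop. 5.32 (every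
homomorphism `Z(𝔤_ℂ) → ℂ` is `χ_λ` for some `λ ∈ 𝔥_ℂ^*`); Clozel 1990, §3.3.
[cite: Knapp2002, §V.5 Thm. 5.44 and Prop. 5.32] [cite: Clozel1990, §3.3] -/
theorem exists_hasHCParameter_of_hasCentralCharacter
    {θ : Subalgebra.center ℝ (UniversalEnvelopingAlgebra ℝ (Matrix (Fin n) (Fin n) 𝕜)) →ₐ[ℝ] ℂ}
    (hθ : HasCentralCharacter ρ𝔤 θ) :
    ∃ χ : (𝕜 →ₐ[ℝ] ℂ) → Multiset ℂ, HasHCParameter ρ𝔤 χ := by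
  classical
  set γ : HarishChandraHomGL 𝕜 n := harishChandraHomGL 𝕜 n with hγdef
  obtain ⟨hinj, hrange⟩ := γ.baseChange_injective_and_range_eq
  -- the complexified character `θ_ℂ : ℂ ⊗_ℝ Z(𝔤) →ₐ[ℂ] ℂ`, `c ⊗ z ↦ c θ(z)`
  let θC : ℂ ⊗[ℝ] Subalgebra.center ℝ (UniversalEnvelopingAlgebra ℝ (Matrix (Fin n) (Fin n) 𝕜)) →ₐ[ℂ] ℂ :=
    Algebra.TensorProduct.lift (Algebra.ofId ℂ ℂ) θ fun _ _ => Commute.all _ _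
  have hθC : ∀ (c : ℂ) (z), θC (c ⊗ₜ z) = c * θ z := fun c z => by
    change Algebra.TensorProduct.lift _ _ _ (c ⊗ₜ z) = _
    rw [Algebra.TensorProduct.lift_tmul, Algebra.ofId_apply]
    rfl
  -- transported to a character `ψ` of the symmetric polynomials along `γ_ℂ`
  let e : (ℂ ⊗[ℝ] Subalgebra.center ℝ (UniversalEnvelopingAlgebra ℝ (Matrix (Fin n) (Fin n) 𝕜))) ≃ₐ[ℂ]
      γ.baseChange.range := AlgEquiv.ofInjective γ.baseChange hinj
  let ι : symmetricSubalgebraGL 𝕜 n ≃ₐ[ℂ] γ.baseChange.range :=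
    Subalgebra.equivOfEq _ _ hrange.symm
  let ψ : symmetricSubalgebraGL 𝕜 n →ₐ[ℂ] ℂ := (θC.comp e.symm.toAlgHom).comp ι.toAlgHom
  -- `ψ(γ z) = θ z`
  have hψγ : ∀ z, ψ ⟨γ.toAlgHom z, γ.toAlgHom_mem_symmetricSubalgebraGL z⟩ = θ z := by
    intro z
    have hmem : γ.toAlgHom z ∈ γ.baseChange.range :=
      (AlgHom.mem_range _).mpr ⟨(1 : ℂ) ⊗ₜ z, by rw [HarishChandraHomGL.baseChange_tmul, one_smul]⟩
    have hι : ι ⟨γ.toAlgHom z, γ.toAlgHom_mem_symmetricSubalgebraGL z⟩ = ⟨γ.toAlgHom z, hmem⟩ :=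
      Subtype.ext rfl
    have he' : e ((1 : ℂ) ⊗ₜ z) = ⟨γ.toAlgHom z, hmem⟩ := Subtype.ext (by
      show ((AlgEquiv.ofInjective γ.baseChange hinj ((1 : ℂ) ⊗ₜ z) : γ.baseChange.range) :
          MvPolynomial ((𝕜 →ₐ[ℝ] ℂ) × Fin n) ℂ) = γ.toAlgHom z
      rw [AlgEquiv.ofInjective_apply, HarishChandraHomGL.baseChange_tmul, one_smul])
    have he : e.symm ⟨γ.toAlgHom z, hmem⟩ = (1 : ℂ) ⊗ₜ z := e.symm_apply_eq.mpr he'.symm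
    change θC (e.symm (ι ⟨γ.toAlgHom z, _⟩)) = θ z
    rw [hι, he, hθC, one_mul]
  -- `ψ` is evaluation at a point `x`
  obtain ⟨x, hx⟩ := exists_point_of_algHom_symmetricSubalgebraGL ψ
  refine ⟨fun τ => Finset.univ.val.map (x τ), fun τ => by simp, θ, hθ, fun γ' l hl z => ?_⟩
  obtain rfl : γ' = γ := harishChandraHomGL_unique_holds γ' γ
  rw [← hψγ z, hx _ (γ.toAlgHom_mem_symmetricSubalgebraGL z)]
  exact aeval_eq_aeval_of_map_univ_eq (γ.toAlgHom_mem_symmetricSubalgebraGL z) fun τ => (hl τ).symm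

/-- Hence: **a module has a Harish-Chandra parameter iff it has an infinitesimal character**
(`exists_hasCentralCharacter_of_hasHCParameter` for the converse). [cite: Knapp2002, §V.5 Thm. 5.44] -/
theorem exists_hasHCParameter_iff_exists_hasCentralCharacter :
    (∃ χ : (𝕜 →ₐ[ℝ] ℂ) → Multiset ℂ, HasHCParameter ρ𝔤 χ) ↔
      ∃ θ : Subalgebra.center ℝ (UniversalEnvelopingAlgebra ℝ (Matrix (Fin n) (Fin n) 𝕜)) →ₐ[ℝ] ℂ,
        HasCentralCharacter ρ𝔤 θ :=
  ⟨fun ⟨_, h⟩ => exists_hasCentralCharacter_of_hasHCParameter ρ𝔤 h,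
    fun ⟨_, hθ⟩ => exists_hasHCParameter_of_hasCentralCharacter ρ𝔤 hθ⟩

end Parameter

/-! ### Enveloping algebras: generation by `𝔤`, push-forward of central characters -/

section Enveloping

variable {L : Type*} [LieRing L] [LieAlgebra ℝ L]

/-- **`U(𝔤)` is generated by `𝔤`**: induction principle (constants, `ι x`, products, sums), from
the presentation of `U(𝔤)` as a quotient of the tensor algebra. Dixmier, *Enveloping Algebras*,
2.1.1. [folklore] -/
theorem UniversalEnvelopingAlgebra.induction_on' {C : UniversalEnvelopingAlgebra ℝ L → Prop}
    (u : UniversalEnvelopingAlgebra ℝ L) (algebraMap : ∀ r : ℝ, C (algebraMap ℝ _ r))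
    (ι : ∀ x : L, C (UniversalEnvelopingAlgebra.ι ℝ x)) (mul : ∀ a b, C a → C b → C (a * b))
    (add : ∀ a b, C a → C b → C (a + b)) : C u := by
  have hs : Function.Surjective (UniversalEnvelopingAlgebra.mkAlgHom ℝ L) := by
    unfold UniversalEnvelopingAlgebra.mkAlgHom
    exact RingCon.mkₐ_surjective _
  obtain ⟨t, rfl⟩ := hs u
  induction t using TensorAlgebra.induction with
  | algebraMap r => rw [AlgHom.commutes]; exact algebraMap r
  | ι x =>
    have h := ι x
    rwa [UniversalEnvelopingAlgebra.ι_apply] at h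
  | mul a b ha hb => rw [map_mul]; exact mul _ _ ha hb
  | add a b ha hb => rw [map_add]; exact add _ _ ha hb

/-- **An element of `U(𝔤)` commuting with `𝔤` is central.** Dixmier 2.1.1. [folklore] -/
theorem UniversalEnvelopingAlgebra.mem_center_of_forall_commute_ι {w : UniversalEnvelopingAlgebra ℝ L}
    (h : ∀ x : L, Commute (UniversalEnvelopingAlgebra.ι ℝ x) w) :
    w ∈ Subalgebra.center ℝ (UniversalEnvelopingAlgebra ℝ L) := by
  rw [Subalgebra.mem_center_iff]
  intro b
  induction b using UniversalEnvelopingAlgebra.induction_on' with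
  | algebraMap r => exact (Algebra.commutes r w)
  | ι x => exact (h x).eq
  | mul a b ha hb => rw [mul_assoc, hb, ← mul_assoc, ha, mul_assoc]
  | add a b ha hb => rw [add_mul, mul_add, ha, hb]

variable {L₂ : Type*} [LieRing L₂] [LieAlgebra ℝ L₂] {A : Type*} [Ring A] [Algebra ℝ A]

/-- **Functoriality of `lift`**: for a Lie algebra map `f : 𝔤₁ → 𝔤₂` and a representation `ρ` of
`𝔤₂`, the action of `U(𝔤₁)` through `ρ ∘ f` is the action of `U(𝔤₂)` through `ρ` composed with
`U(f) : U(𝔤₁) → U(𝔤₂)` (`U(f)` = `lift (ι ∘ f)`). Dixmier 2.1. [folklore] -/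
theorem UniversalEnvelopingAlgebra.lift_comp_apply (f : L →ₗ⁅ℝ⁆ L₂) (ρ : L₂ →ₗ⁅ℝ⁆ A)
    (u : UniversalEnvelopingAlgebra ℝ L) :
    UniversalEnvelopingAlgebra.lift ℝ (ρ.comp f) u =
      UniversalEnvelopingAlgebra.lift ℝ ρ
        (UniversalEnvelopingAlgebra.lift ℝ ((UniversalEnvelopingAlgebra.ι ℝ).comp f) u) := by
  have h : ((UniversalEnvelopingAlgebra.lift ℝ ρ).comp
      (UniversalEnvelopingAlgebra.lift ℝ ((UniversalEnvelopingAlgebra.ι ℝ).comp f)) :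
        UniversalEnvelopingAlgebra ℝ L → A) ∘ UniversalEnvelopingAlgebra.ι ℝ = ρ.comp f := by
    funext x
    simp only [Function.comp_apply, AlgHom.comp_apply, UniversalEnvelopingAlgebra.lift_ι_apply,
      LieHom.comp_apply]
  rw [← (UniversalEnvelopingAlgebra.lift_unique ℝ (ρ.comp f) _).mp h]
  rfl

variable {V : Type*} [AddCommGroup V] [Module ℂ V]

/-- **Pull-back of an infinitesimal character**: if `ρ : 𝔤₂ → End V` has central character `θ`
and `U(f)` maps `Z(𝔤₁)` into `Z(𝔤₂)` (e.g. `f` the inclusion of a direct factor), then `ρ ∘ f`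
has the central character `θ ∘ U(f)|_{Z(𝔤₁)}`. Knapp–Vogan, §I.4. [folklore] -/
theorem HasCentralCharacter.exists_comp (f : L →ₗ⁅ℝ⁆ L₂) {ρ : L₂ →ₗ⁅ℝ⁆ Module.End ℂ V}
    {θ : Subalgebra.center ℝ (UniversalEnvelopingAlgebra ℝ L₂) →ₐ[ℝ] ℂ}
    (hθ : HasCentralCharacter ρ θ)
    (hf : ∀ z ∈ Subalgebra.center ℝ (UniversalEnvelopingAlgebra ℝ L),
      UniversalEnvelopingAlgebra.lift ℝ ((UniversalEnvelopingAlgebra.ι ℝ).comp f) z ∈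
        Subalgebra.center ℝ (UniversalEnvelopingAlgebra ℝ L₂)) :
    ∃ θ₁ : Subalgebra.center ℝ (UniversalEnvelopingAlgebra ℝ L) →ₐ[ℝ] ℂ,
      HasCentralCharacter (ρ.comp f) θ₁ := by
  let Uf := UniversalEnvelopingAlgebra.lift ℝ ((UniversalEnvelopingAlgebra.ι ℝ).comp f)
  let g : Subalgebra.center ℝ (UniversalEnvelopingAlgebra ℝ L) →ₐ[ℝ]
      Subalgebra.center ℝ (UniversalEnvelopingAlgebra ℝ L₂) :=
    (Uf.comp (Subalgebra.center ℝ (UniversalEnvelopingAlgebra ℝ L)).val).codRestrict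
      (Subalgebra.center ℝ (UniversalEnvelopingAlgebra ℝ L₂)) fun z => hf z z.2
  refine ⟨θ.comp g, fun z => ?_⟩
  rw [UniversalEnvelopingAlgebra.lift_comp_apply, AlgHom.comp_apply]
  exact hθ (g z)

end Enveloping

/-! ### The place factors of `𝔤𝔩ₙ(K_∞)` commute and span -/

section PlaceFactors

open scoped Classical
open NumberField NumberField.InfinitePlace NumberField.mixedEmbedding

variable {K : Type*} [Field K] (n : ℕ)

omit n in
/-- Products of the unit vectors of two distinct factors of `K_∞` vanish. [folklore] -/
private theorem single_mul_single_eq_zero {ι : Type*} [DecidableEq ι] {R : ι → Type*}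
    [∀ i, MulZeroClass (R i)] {i j : ι} (h : i ≠ j) (a : R i) (b : R j) :
    (Pi.single i a : ∀ k, R k) * Pi.single j b = 0 := by
  funext k
  rw [Pi.mul_apply, Pi.zero_apply]
  by_cases hk : k = j
  · subst hk
    rw [Pi.single_eq_of_ne (Ne.symm h), zero_mul]
  · rw [Pi.single_eq_of_ne hk, mul_zero]

/-- Matrices supported on two distinct real factors of `𝔤𝔩ₙ(K_∞)` have product zero. [folklore] -/
theorem realPlaceLie_mul_realPlaceLie_of_ne {w w' : {w : InfinitePlace K // IsReal w}} (h : w ≠ w')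
    (X Y : Matrix (Fin n) (Fin n) ℝ) : realPlaceLie n w X * realPlaceLie n w' Y = 0 := by
  refine Matrix.ext fun i j => ?_
  rw [Matrix.mul_apply, Matrix.zero_apply]
  refine Finset.sum_eq_zero fun k _ => ?_
  rw [realPlaceLie_apply, realPlaceLie_apply, Prod.mk_mul_mk, single_mul_single_eq_zero h,
    mul_zero, Prod.mk_zero_zero]

/-- Matrices supported on two distinct complex factors of `𝔤𝔩ₙ(K_∞)` have product zero.
[folklore] -/
theorem complexPlaceLie_mul_complexPlaceLie_of_ne {w w' : {w : InfinitePlace K // IsComplex w}}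
    (h : w ≠ w') (X Y : Matrix (Fin n) (Fin n) ℂ) :
    complexPlaceLie n w X * complexPlaceLie n w' Y = 0 := by
  refine Matrix.ext fun i j => ?_
  rw [Matrix.mul_apply, Matrix.zero_apply]
  refine Finset.sum_eq_zero fun k _ => ?_
  rw [complexPlaceLie_apply, complexPlaceLie_apply, Prod.mk_mul_mk, single_mul_single_eq_zero h,
    mul_zero, Prod.mk_zero_zero]

/-- Matrices supported on a real and a complex factor of `𝔤𝔩ₙ(K_∞)` have product zero.
[folklore] -/
theorem realPlaceLie_mul_complexPlaceLie (w : {w : InfinitePlace K // IsReal w})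
    (w' : {w : InfinitePlace K // IsComplex w}) (X : Matrix (Fin n) (Fin n) ℝ)
    (Y : Matrix (Fin n) (Fin n) ℂ) : realPlaceLie n w X * complexPlaceLie n w' Y = 0 := by
  refine Matrix.ext fun i j => ?_
  rw [Matrix.mul_apply, Matrix.zero_apply]
  refine Finset.sum_eq_zero fun k _ => ?_
  rw [realPlaceLie_apply, complexPlaceLie_apply, Prod.mk_mul_mk, mul_zero, zero_mul,
    Prod.mk_zero_zero]

/-- Matrices supported on a complex and a real factor of `𝔤𝔩ₙ(K_∞)` have product zero.
[folklore] -/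
theorem complexPlaceLie_mul_realPlaceLie (w : {w : InfinitePlace K // IsComplex w})
    (w' : {w : InfinitePlace K // IsReal w}) (X : Matrix (Fin n) (Fin n) ℂ)
    (Y : Matrix (Fin n) (Fin n) ℝ) : complexPlaceLie n w X * realPlaceLie n w' Y = 0 := by
  refine Matrix.ext fun i j => ?_
  rw [Matrix.mul_apply, Matrix.zero_apply]
  refine Finset.sum_eq_zero fun k _ => ?_
  rw [complexPlaceLie_apply, realPlaceLie_apply, Prod.mk_mul_mk, mul_zero, zero_mul,
    Prod.mk_zero_zero]

/-- **`𝔤𝔩ₙ(K_∞) = ⨁_{w real} 𝔤𝔩ₙ(ℝ) ⊕ ⨁_{w complex} 𝔤𝔩ₙ(ℂ)`**: every matrix over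
`K_∞ = ∏_{w real} ℝ × ∏_{w complex} ℂ` is the sum of its place components. [folklore] -/
theorem eq_sum_realPlaceLie_add_sum_complexPlaceLie [NumberField K]
    (M : Matrix (Fin n) (Fin n) (mixedSpace K)) :
    M = ∑ w : {w : InfinitePlace K // IsReal w}, realPlaceLie n w (M.map fun a => a.1 w) +
      ∑ w : {w : InfinitePlace K // IsComplex w}, complexPlaceLie n w (M.map fun a => a.2 w) := by
  ext i j
  · simp only [Matrix.add_apply, Matrix.sum_apply, realPlaceLie_apply, complexPlaceLie_apply,
      Matrix.map_apply, Prod.fst_add, Prod.fst_sum, Finset.sum_const_zero, add_zero]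
    rw [Finset.univ_sum_single]
  · simp only [Matrix.add_apply, Matrix.sum_apply, realPlaceLie_apply, complexPlaceLie_apply,
      Matrix.map_apply, Prod.snd_add, Prod.snd_sum, Finset.sum_const_zero, zero_add]
    rw [Finset.univ_sum_single]

end PlaceFactors

/-! ### Restriction of an infinitesimal character of `𝔤𝔩ₙ(K_∞)` to the place factors -/

section Restriction

open scoped Classical
open NumberField NumberField.InfinitePlace NumberField.mixedEmbedding

-- `K : Type` (universe `0`), as for the automorphic data of `AutomorphicRepsGL` and the embedding
-- lemmas of `ArchParameterUnique` used below
variable {K : Type} [Field K] [NumberField K] {n : ℕ}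

local notation "𝔤∞" => Matrix (Fin n) (Fin n) (mixedSpace K)

-- The inclusion `𝔤𝔩ₙ(K_∞) ≅ ⊤ ≤ 𝔤𝔩ₙ(K_∞)` (inverse of Mathlib's `LieSubalgebra.topEquiv`), the form
-- in which the Lie algebra of the `GL_n` datum is presented (`AutomorphicRepData.HasArchParameter`).
local notation "toTop" =>
  (LieEquiv.toLieHom (LieEquiv.symm (LieSubalgebra.topEquiv :
    (⊤ : LieSubalgebra ℝ (Matrix (Fin n) (Fin n) (mixedSpace K))) ≃ₗ⁅ℝ⁆
      Matrix (Fin n) (Fin n) (mixedSpace K))))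

omit n in
/-- In `U(𝔤)`, `ι a` and `ι b` commute when `a b = b a = 0`... more precisely when `⁅a, b⁆ = 0`.
[folklore] -/
private theorem commute_ι_of_lie_eq_zero {L : Type*} [LieRing L] [LieAlgebra ℝ L] {a b : L}
    (h : ⁅a, b⁆ = 0) :
    Commute (UniversalEnvelopingAlgebra.ι ℝ a) (UniversalEnvelopingAlgebra.ι ℝ b) := by
  have h1 : ⁅UniversalEnvelopingAlgebra.ι ℝ a, UniversalEnvelopingAlgebra.ι ℝ b⁆ =
      (0 : UniversalEnvelopingAlgebra ℝ L) := by
    rw [← LieHom.map_lie, h, map_zero]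
  rw [LieRing.of_associative_ring_bracket, sub_eq_zero] at h1
  exact h1

/-- **`U` of the inclusion of a factor maps into the commutant of the other factors**: if
`⁅f x, Y⁆ = 0` for all `x`, then `U(f)(u)` commutes with `ι Y` for every `u ∈ U(𝔤₁)`. [folklore] -/
private theorem commute_ι_lift_of_forall_lie_eq_zero {L₁ L₂ : Type*} [LieRing L₁] [LieAlgebra ℝ L₁]
    [LieRing L₂] [LieAlgebra ℝ L₂] (f : L₁ →ₗ⁅ℝ⁆ L₂) {Y : L₂} (hY : ∀ x : L₁, ⁅f x, Y⁆ = 0)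
    (u : UniversalEnvelopingAlgebra ℝ L₁) :
    Commute (UniversalEnvelopingAlgebra.ι ℝ Y)
      (UniversalEnvelopingAlgebra.lift ℝ ((UniversalEnvelopingAlgebra.ι ℝ).comp f) u) := by
  induction u using UniversalEnvelopingAlgebra.induction_on' with
  | algebraMap r => rw [AlgHom.commutes]; exact Algebra.commute_algebraMap_right r _
  | ι x =>
    rw [UniversalEnvelopingAlgebra.lift_ι_apply, LieHom.comp_apply]
    exact (commute_ι_of_lie_eq_zero (hY x)).symm
  | mul a b ha hb => rw [map_mul]; exact ha.mul_right hb
  | add a b ha hb => rw [map_add]; exact ha.add_right hb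

/-- **`U` of the inclusion of a factor maps the centre into the commutant of that factor.**
[folklore] -/
private theorem commute_ι_lift_of_mem_center {L₁ L₂ : Type*} [LieRing L₁] [LieAlgebra ℝ L₁]
    [LieRing L₂] [LieAlgebra ℝ L₂] (f : L₁ →ₗ⁅ℝ⁆ L₂) (x : L₁)
    {z : UniversalEnvelopingAlgebra ℝ L₁} (hz : z ∈ Subalgebra.center ℝ (UniversalEnvelopingAlgebra ℝ L₁)) :
    Commute (UniversalEnvelopingAlgebra.ι ℝ (f x))
      (UniversalEnvelopingAlgebra.lift ℝ ((UniversalEnvelopingAlgebra.ι ℝ).comp f) z) := by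
  have hx : UniversalEnvelopingAlgebra.ι ℝ (f x) =
      UniversalEnvelopingAlgebra.lift ℝ ((UniversalEnvelopingAlgebra.ι ℝ).comp f)
        (UniversalEnvelopingAlgebra.ι ℝ x) := by
    rw [UniversalEnvelopingAlgebra.lift_ι_apply, LieHom.comp_apply]
  rw [Subalgebra.mem_center_iff] at hz
  change _ * _ = _ * _
  rw [hx, ← map_mul, ← map_mul, hz]

/-- **The centre of `U(𝔤𝔩ₙ(ℝ)) = U(𝔤𝔩ₙ(K_w))`, `w` real, maps into the centre of `U(𝔤𝔩ₙ(K_∞))`**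
(the factors of `𝔤𝔩ₙ(K_∞) = ⨁_w 𝔤𝔩ₙ(K_w)` commute, `𝔤` generates `U(𝔤)`). [folklore] -/
theorem lift_realPlaceLie_mem_center (w : {w : InfinitePlace K // IsReal w})
    {z : UniversalEnvelopingAlgebra ℝ (Matrix (Fin n) (Fin n) ℝ)}
    (hz : z ∈ Subalgebra.center ℝ (UniversalEnvelopingAlgebra ℝ (Matrix (Fin n) (Fin n) ℝ))) :
    UniversalEnvelopingAlgebra.lift ℝ
        ((UniversalEnvelopingAlgebra.ι ℝ).comp (LieHom.comp toTop (realPlaceLie n w))) z ∈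
      Subalgebra.center ℝ (UniversalEnvelopingAlgebra ℝ (⊤ : LieSubalgebra ℝ 𝔤∞)) := by
  classical
  refine UniversalEnvelopingAlgebra.mem_center_of_forall_commute_ι fun Y => ?_
  -- decompose `Y` along the place factors
  have hY : Y = toTop (LieSubalgebra.topEquiv Y) := (LieEquiv.symm_apply_apply _ Y).symm
  rw [hY, eq_sum_realPlaceLie_add_sum_complexPlaceLie n (LieSubalgebra.topEquiv Y), map_add,
    map_sum, map_sum, map_add, map_sum, map_sum]
  refine Commute.add_left (Commute.sum_left _ _ _ fun w' _ => ?_)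
    (Commute.sum_left _ _ _ fun w' _ => ?_)
  · by_cases hw : w' = w
    · subst hw
      exact commute_ι_lift_of_mem_center (LieHom.comp toTop (realPlaceLie n w')) _ hz
    · refine commute_ι_lift_of_forall_lie_eq_zero _ (fun x => ?_) z
      rw [LieHom.comp_apply, ← LieHom.map_lie, LieRing.of_associative_ring_bracket,
        realPlaceLie_mul_realPlaceLie_of_ne n (Ne.symm hw), realPlaceLie_mul_realPlaceLie_of_ne n hw,
        sub_zero, map_zero]
  · refine commute_ι_lift_of_forall_lie_eq_zero _ (fun x => ?_) z
    rw [LieHom.comp_apply, ← LieHom.map_lie, LieRing.of_associative_ring_bracket,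
      realPlaceLie_mul_complexPlaceLie, complexPlaceLie_mul_realPlaceLie, sub_zero, map_zero]

/-- **The centre of `U(𝔤𝔩ₙ(ℂ)) = U(𝔤𝔩ₙ(K_w))`, `w` complex, maps into the centre of
`U(𝔤𝔩ₙ(K_∞))`.** [folklore] -/
theorem lift_complexPlaceLie_mem_center (w : {w : InfinitePlace K // IsComplex w})
    {z : UniversalEnvelopingAlgebra ℝ (Matrix (Fin n) (Fin n) ℂ)}
    (hz : z ∈ Subalgebra.center ℝ (UniversalEnvelopingAlgebra ℝ (Matrix (Fin n) (Fin n) ℂ))) :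
    UniversalEnvelopingAlgebra.lift ℝ
        ((UniversalEnvelopingAlgebra.ι ℝ).comp (LieHom.comp toTop (complexPlaceLie n w))) z ∈
      Subalgebra.center ℝ (UniversalEnvelopingAlgebra ℝ (⊤ : LieSubalgebra ℝ 𝔤∞)) := by
  classical
  refine UniversalEnvelopingAlgebra.mem_center_of_forall_commute_ι fun Y => ?_
  have hY : Y = toTop (LieSubalgebra.topEquiv Y) := (LieEquiv.symm_apply_apply _ Y).symm
  rw [hY, eq_sum_realPlaceLie_add_sum_complexPlaceLie n (LieSubalgebra.topEquiv Y), map_add,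
    map_sum, map_sum, map_add, map_sum, map_sum]
  refine Commute.add_left (Commute.sum_left _ _ _ fun w' _ => ?_)
    (Commute.sum_left _ _ _ fun w' _ => ?_)
  · refine commute_ι_lift_of_forall_lie_eq_zero _ (fun x => ?_) z
    rw [LieHom.comp_apply, ← LieHom.map_lie, LieRing.of_associative_ring_bracket,
      complexPlaceLie_mul_realPlaceLie, realPlaceLie_mul_complexPlaceLie, sub_zero, map_zero]
  · by_cases hw : w' = w
    · subst hw
      exact commute_ι_lift_of_mem_center (LieHom.comp toTop (complexPlaceLie n w')) _ hz
    · refine commute_ι_lift_of_forall_lie_eq_zero _ (fun x => ?_) z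
      rw [LieHom.comp_apply, ← LieHom.map_lie, LieRing.of_associative_ring_bracket,
        complexPlaceLie_mul_complexPlaceLie_of_ne n (Ne.symm hw),
        complexPlaceLie_mul_complexPlaceLie_of_ne n hw, sub_zero, map_zero]

/-- **A representation of `𝔤𝔩ₙ(K_∞)` with an infinitesimal character has a Harish-Chandra
parameter at every real place**: its restriction to the factor `𝔤𝔩ₙ(ℝ) = 𝔤𝔩ₙ(K_w)` has an
infinitesimal character (`HasCentralCharacter.exists_comp`, `lift_realPlaceLie_mem_center`), hence
a Harish-Chandra parameter (`exists_hasHCParameter_of_hasCentralCharacter`).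
[cite: Knapp2002, §V.5 Thm. 5.44] -/
theorem exists_hasHCParameter_realPlace_of_hasCentralCharacter
    {V : Type*} [AddCommGroup V] [Module ℂ V] (ρ𝔤 : (⊤ : LieSubalgebra ℝ 𝔤∞) →ₗ⁅ℝ⁆ Module.End ℂ V)
    {θ : Subalgebra.center ℝ (UniversalEnvelopingAlgebra ℝ (⊤ : LieSubalgebra ℝ 𝔤∞)) →ₐ[ℝ] ℂ}
    (hθ : HasCentralCharacter ρ𝔤 θ) (w : {w : InfinitePlace K // IsReal w}) :
    ∃ χ : (ℝ →ₐ[ℝ] ℂ) → Multiset ℂ,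
      HasHCParameter (𝕜 := ℝ) ((ρ𝔤.comp toTop).comp (realPlaceLie n w)) χ := by
  obtain ⟨θ₁, hθ₁⟩ := hθ.exists_comp (LieHom.comp toTop (realPlaceLie n w))
    (fun z hz => lift_realPlaceLie_mem_center w hz)
  exact exists_hasHCParameter_of_hasCentralCharacter _ hθ₁

/-- Likewise **at every complex place**. [cite: Knapp2002, §V.5 Thm. 5.44] -/
theorem exists_hasHCParameter_complexPlace_of_hasCentralCharacter
    {V : Type*} [AddCommGroup V] [Module ℂ V] (ρ𝔤 : (⊤ : LieSubalgebra ℝ 𝔤∞) →ₗ⁅ℝ⁆ Module.End ℂ V)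
    {θ : Subalgebra.center ℝ (UniversalEnvelopingAlgebra ℝ (⊤ : LieSubalgebra ℝ 𝔤∞)) →ₐ[ℝ] ℂ}
    (hθ : HasCentralCharacter ρ𝔤 θ) (w : {w : InfinitePlace K // IsComplex w}) :
    ∃ χ : (ℂ →ₐ[ℝ] ℂ) → Multiset ℂ,
      HasHCParameter (𝕜 := ℂ) ((ρ𝔤.comp toTop).comp (complexPlaceLie n w)) χ := by
  obtain ⟨θ₁, hθ₁⟩ := hθ.exists_comp (LieHom.comp toTop (complexPlaceLie n w))
    (fun z hz => lift_complexPlaceLie_mem_center w hz)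
  exact exists_hasHCParameter_of_hasCentralCharacter _ hθ₁

/-- **A representation of `𝔤𝔩ₙ(K_∞)` with an infinitesimal character has an archimedean
parameter** (`HasArchParameter` of `ArchimedeanGLn`: a Harish-Chandra parameter at every place,
indexed by the complex embeddings of `K`): assemble the parameters of the place factors, using
that every `σ : K →+* ℂ` is `w.embedding` for the real place `w = mk σ`, or one of `w.embedding`,
`conj ∘ w.embedding` for the complex place `w = mk σ`. Clozel 1990, §3.3; Knapp 2002, Thm. 5.44.
[cite: Clozel1990, §3.3] [cite: Knapp2002, §V.5 Thm. 5.44] -/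
theorem exists_hasArchParameter_of_hasCentralCharacter
    {V : Type*} [AddCommGroup V] [Module ℂ V] (ρ𝔤 : (⊤ : LieSubalgebra ℝ 𝔤∞) →ₗ⁅ℝ⁆ Module.End ℂ V)
    {θ : Subalgebra.center ℝ (UniversalEnvelopingAlgebra ℝ (⊤ : LieSubalgebra ℝ 𝔤∞)) →ₐ[ℝ] ℂ}
    (hθ : HasCentralCharacter ρ𝔤 θ) :
    ∃ χ : (K →+* ℂ) → Multiset ℂ, HasArchParameter (ρ𝔤.comp toTop) χ := by
  classical
  choose χre hre using exists_hasHCParameter_realPlace_of_hasCentralCharacter ρ𝔤 hθ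
  choose χco hco using exists_hasHCParameter_complexPlace_of_hasCentralCharacter ρ𝔤 hθ
  -- the assembled family
  let χ : (K →+* ℂ) → Multiset ℂ := fun σ =>
    if h : (mk σ).IsReal then χre ⟨mk σ, h⟩ (Algebra.ofId ℝ ℂ)
    else χco ⟨mk σ, not_isReal_iff_isComplex.mp h⟩
      (if σ = (mk σ).embedding then AlgHom.id ℝ ℂ else Complex.conjAe)
  have hχco : ∀ (σ : K →+* ℂ) (hσ : (mk σ).IsComplex),
      χ σ = χco ⟨mk σ, hσ⟩ (if σ = (mk σ).embedding then AlgHom.id ℝ ℂ else Complex.conjAe) := by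
    intro σ hσ
    simp only [χ, dif_neg (not_isReal_iff_isComplex.mpr hσ)]
  refine ⟨χ, fun w => ?_, fun w => ?_⟩
  · -- real place `w`: the unique real embedding `ℝ → ℂ`
    have hfam : (fun _ : ℝ →ₐ[ℝ] ℂ => χ w.1.embedding) = χre w := by
      funext τ
      have hτ : τ = Algebra.ofId ℝ ℂ := AlgHom.ext fun r => τ.commutes r
      have hreal : (mk w.1.embedding).IsReal := by rw [mk_embedding]; exact w.2
      have hw : (⟨mk w.1.embedding, hreal⟩ : {w : InfinitePlace K // IsReal w}) = w :=
        Subtype.ext (mk_embedding w.1)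
      simp only [χ, dif_pos hreal]
      rw [hw, hτ]
    rw [hfam]
    exact hre w
  · -- complex place `w`: `τ ∘ σ_w` is `σ_w` or its conjugate
    have hfam : (fun τ : ℂ →ₐ[ℝ] ℂ => χ (τ.toRingHom.comp w.1.embedding)) = χco w := by
      funext τ
      have hne : ComplexEmbedding.conjugate w.1.embedding ≠ w.1.embedding := fun h =>
        (not_isReal_iff_isComplex.mpr w.2) (isReal_iff.mpr (ComplexEmbedding.isReal_iff.mpr h))
      rcases Complex.real_algHom_eq_id_or_conj τ with rfl | rfl
      · rw [algHomId_toRingHom_comp]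
        have hc : (mk w.1.embedding).IsComplex := by rw [mk_embedding]; exact w.2
        rw [hχco _ hc]
        have hw : (⟨mk w.1.embedding, hc⟩ : {w : InfinitePlace K // IsComplex w}) = w :=
          Subtype.ext (mk_embedding w.1)
        rw [hw, mk_embedding, if_pos rfl]
      · rw [conjAe_toRingHom_comp]
        have hc : (mk (ComplexEmbedding.conjugate w.1.embedding)).IsComplex := by
          rw [mk_conjugate_eq, mk_embedding]; exact w.2
        rw [hχco _ hc]
        have hw : (⟨mk (ComplexEmbedding.conjugate w.1.embedding), hc⟩ :
            {w : InfinitePlace K // IsComplex w}) = w :=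
          Subtype.ext (by
            show InfinitePlace.mk (ComplexEmbedding.conjugate w.1.embedding) = w.1
            rw [mk_conjugate_eq, mk_embedding])
        rw [hw, mk_conjugate_eq, mk_embedding, if_neg hne]
    rw [hfam]
    exact hco w

end Restriction

/-! ### Automorphic representations: infinitesimal character ⟹ archimedean parameter -/

section Automorphic

open scoped Classical
open NumberField

variable {K : Type} [Field K] [NumberField K] {n : ℕ} {hcpt : isCompact_glFiniteIntegralLevel n K}
  (π : AutomorphicRepData (AutomorphyDatum.gl n K hcpt))

/-- **An automorphic representation of `GL_n(𝔸_K)` with an infinitesimal character has an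
archimedean parameter** (`AutomorphicRepData.HasArchParameter`): if `Z(𝔤)`, `𝔤 = 𝔤𝔩ₙ(K_∞)`,
acts on `W / W'` by a character `θ` (`AutomorphicRepData.HasInfinitesimalCharacter`, Borel–Jacquet
1979, 4.6), then `π` has Harish-Chandra parameters at all places — the centre of each factor
`U(𝔤𝔩ₙ(K_w))` is central in `U(𝔤)` and acts by the restricted character, whose values are those
of Harish-Chandra's homomorphism at a point (`exists_hasHCParameter_of_hasCentralCharacter`). So
the existence of an archimedean parameter (the `HasArchParameter` half of Clozel's existence of an
infinity type, `AutomorphicRepData.exists_hasInfinityType`) reduces to Schur's lemma for `W / W'`.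
Clozel 1990, §3.3; Borel–Jacquet 1979, 4.6; Knapp 2002, Thm. 5.44.
[cite: Clozel1990, §3.3] [cite: BorelJacquet1979, 4.6] [cite: Knapp2002, §V.5 Thm. 5.44] -/
theorem AutomorphicRepData.exists_hasArchParameter_of_hasInfinitesimalCharacter
    {θ : centerU (AutomorphyDatum.gl n K hcpt).arch →ₐ[ℝ] ℂ} (hθ : π.HasInfinitesimalCharacter θ) :
    ∃ χ : (K →+* ℂ) → Multiset ℂ, π.HasArchParameter χ := by
  obtain ⟨ρ𝔤, hρ, hθρ⟩ := hθ
  rw [hasInfinitesimalCharacter_iff_hasCentralCharacter] at hθρ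
  obtain ⟨χ, hχ⟩ := exists_hasArchParameter_of_hasCentralCharacter ρ𝔤 hθρ
  exact ⟨χ, ρ𝔤, hρ, hχ⟩

end Automorphic

end Literature.NumberTheory.Automorphic
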